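import Summits.CriticalPhenomena.PercolationContinuityZ3.Theorems.Transplant.PatternGraphHeisenbergSkew
import HarnessLib

/-!
# The Heisenberg skew bilayer IS VERTEX-TRANSITIVE, in the kernel: the flip `σ(x,y,z) = (−x,−y,z)` of `H₃(ℤ)` and the SHEET SWAP `(h, j) ↦ (σ h, 1 − j)` —
# and the swap NEGATES the abelianisation chart, so the transitive group `⟨H₃(ℤ), swap⟩` does NOT translate it (the Aut-level content of the words of customer (c1))

builds on p205010 (kernel theorem, internal audit signed; external expert review pending) — nothing in this file uses p205010; nothing here is a claim about any open
node.  Lane `prim-bschramm`, seat `prim-hp-8` gen 59, row (k1) BY NAME from the design owner (p3 gen 28, bus 2026-08-27 «GO (k1)»).  Helper file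
(`--supports stmt-CriticalPhenomena-4575 --as helper`).

CONTEXT.  «PatternGraphHeisenbergSkew» (p496924) proves `θ_v(p_c) = 0 ∧ p_c < 1` on the pattern graph `X := PatternGraph.graph Heis3Skew.P` on `H₃(ℤ) × Fin 2`
(in-sheet bonds `(h, j) ∼ (h a^{±1}, j)`, `(h, j) ∼ (h b^{±1}, j)`; skew rungs `(h, 0) ∼ (h a, 1)`, `(h, 0) ∼ (h b, 1)`) and says IN WORDS that `X` is the coset
picture of the Cayley graph `Cay(H₃(ℤ) ⋊ C₂; a, b, aσ, bσ)`, hence vertex-transitive, with the Aut-status of a rank-two TRANSLATING chart open (rule P5-SHARPNESS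
§59.3 / P3-NILPOTENT §20.7: CUSTOMER, no 'first'/'outside' word).  This file types the Aut-level part of those words:
* `Heis3.flipFun` / **`Heis3.flip : Heis3 ≃* Heis3`**, `(x,y,z) ↦ (−x,−y,z)` — a multiplicative INVOLUTION with `σ a = a⁻¹`, `σ b = b⁻¹`, `σ c = c`
  (`flipFun_gA`, `flipFun_gB`, `flipFun_gC`, `flipFun_flipFun`);
* the pattern is flip–swap invariant: `(s, j′) ∈ P j → (σ s, 1 − j′) ∈ P (1 − j)` (`mem_P_swap`);
* **`Heis3Skew.swapIso : X ≃g X`, `(h, j) ↦ (σ h, 1 − j)`** (= left multiplication by `σ` in `H₃ ⋊ C₂` read on the two cosets), an involution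
  (`swapFun_swapFun`) with `swap ∘ L_g = L_{σ g} ∘ swap` (`swapFun_leftIso`), so `⟨L_{H₃}, swap⟩ = L_{H₃} ⋊ ⟨swap⟩` acts simply transitively;
* **`Heis3Skew.vertexTransitive : ∀ u w, ∃ γ : X ≃g X, γ u = w`**;
* **`Heis3Skew.chart_swap : φ (swapIso w).1 = −φ w.1`** and **`Heis3Skew.not_chart_transl_swap`**: the `chart_transl` clause of the orbit theorem
  (`AutChart.criticalContinuity_of_autSubgroup_finite_orbits`: `φ (α w) = φ w + (φ (α t) − φ t)`) FAILS for `α = swap` — the abelianisation chart is not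
  translated by the transitive group exhibited here.  Other automorphisms / other charts are not excluded: the one-type-ability of `X` stays OPEN, the words of
  p496924 stand unchanged (CUSTOMER).
[cite: BenjaminiSchramm1996, §2 (Cayley graphs, quasi-transitive graphs)] [this work]
-/

noncomputable section

namespace Summit.CriticalPhenomena.PercolationContinuityZ3.Theorems.Transplant

open MeasureTheory Literature.Probability.Percolation Literature.Probability.LatticeModels SimpleGraph
open scoped Classical

/-! ## §1 The flip `σ(x,y,z) = (−x,−y,z)`, a multiplicative involution of `H₃(ℤ)` inverting `a` and `b` -/

namespace Heis3

/-- The flip as a map: `σ(x,y,z) = (−x,−y,z)`. [folklore] -/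
def flipFun (g : Heis3) : Heis3 := ⟨-g.x, -g.y, g.z⟩

/-- `x`-coordinate of the flip. [folklore] -/
@[simp] theorem flipFun_x (g : Heis3) : (flipFun g).x = -g.x := rfl
/-- `y`-coordinate of the flip. [folklore] -/
@[simp] theorem flipFun_y (g : Heis3) : (flipFun g).y = -g.y := rfl
/-- `z`-coordinate of the flip. [folklore] -/
@[simp] theorem flipFun_z (g : Heis3) : (flipFun g).z = g.z := rfl

/-- **`σ` is an involution.** [folklore] -/
@[simp] theorem flipFun_flipFun (g : Heis3) : flipFun (flipFun g) = g := by
  ext <;> simp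

/-- **`σ` is multiplicative** (`z″ = z + z′ + x y′` is even in `(x, y′)`). [folklore] -/
theorem flipFun_mul (g h : Heis3) : flipFun (g * h) = flipFun g * flipFun h := by
  ext <;> simp only [flipFun_x, flipFun_y, flipFun_z, mul_x, mul_y, mul_z] <;> ring

/-- `σ 1 = 1`. [folklore] -/
@[simp] theorem flipFun_one : flipFun 1 = 1 := by decide

/-- `σ a = a⁻¹`. [folklore] -/
@[simp] theorem flipFun_gA : flipFun gA = gA⁻¹ := by decide
/-- `σ b = b⁻¹`. [folklore] -/
@[simp] theorem flipFun_gB : flipFun gB = gB⁻¹ := by decide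
/-- `σ c = c` (the centre is fixed pointwise). [folklore] -/
@[simp] theorem flipFun_gC : flipFun gC = gC := by decide
/-- `σ a⁻¹ = a`. [folklore] -/
@[simp] theorem flipFun_gA_inv : flipFun gA⁻¹ = gA := by decide
/-- `σ b⁻¹ = b`. [folklore] -/
@[simp] theorem flipFun_gB_inv : flipFun gB⁻¹ = gB := by decide

/-- `σ` commutes with inversion. [folklore] -/
theorem flipFun_inv (g : Heis3) : flipFun g⁻¹ = (flipFun g)⁻¹ := by
  ext <;> simp only [flipFun_x, flipFun_y, flipFun_z, inv_x, inv_y, inv_z]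
  ring

/-- **The flip `σ : H₃(ℤ) ≃* H₃(ℤ)`** — the automorphism by which `C₂` acts in `H₃(ℤ) ⋊ C₂`. [folklore] -/
def flip : Heis3 ≃* Heis3 where
  toFun := flipFun
  invFun := flipFun
  left_inv := flipFun_flipFun
  right_inv := flipFun_flipFun
  map_mul' := flipFun_mul

/-- `flip g = σ g`. [folklore] -/
@[simp] theorem flip_apply (g : Heis3) : flip g = flipFun g := rfl

/-- `flip` is its own inverse. [folklore] -/
@[simp] theorem flip_symm : flip.symm = flip := rfl

/-- The abelianisation chart is NEGATED by the flip: `φ (σ g) = −φ g`. [folklore] -/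
theorem φ_flipFun (g : Heis3) : φ (flipFun g) = -φ g := by
  funext i; fin_cases i <;> simp [φ]

end Heis3

/-! ## §2 The sheet swap of the Heisenberg skew bilayer -/

namespace Heis3Skew

open Heis3 (gA gB gC φ φ_mul flipFun flipFun_flipFun flipFun_mul φ_flipFun)

/-- **The pattern is flip–swap invariant**: a letter `(s, j′)` of sheet `j` flips to the letter `(σ s, 1 − j′)` of sheet `1 − j`. [this work] -/
theorem mem_P_swap : ∀ j : Fin 2, ∀ p ∈ P j, (flipFun p.1, 1 - p.2) ∈ P (1 - j) := by
  decide

/-- The sheet swap as a map: `(h, j) ↦ (σ h, 1 − j)`. [this work] -/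
def swapFun (a : Heis3 × Fin 2) : Heis3 × Fin 2 := (flipFun a.1, 1 - a.2)

/-- First coordinate of the swap. [this work] -/
@[simp] theorem swapFun_fst (a : Heis3 × Fin 2) : (swapFun a).1 = flipFun a.1 := rfl

/-- Second coordinate of the swap. [this work] -/
@[simp] theorem swapFun_snd (a : Heis3 × Fin 2) : (swapFun a).2 = 1 - a.2 := rfl

/-- **The swap is an involution.** [this work] -/
@[simp] theorem swapFun_swapFun (a : Heis3 × Fin 2) : swapFun (swapFun a) = a :=
  Prod.ext (flipFun_flipFun a.1) (sub_sub_cancel 1 a.2)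

/-- The swap is injective. [this work] -/
theorem swapFun_injective : Function.Injective swapFun := fun a b h => by
  simpa only [swapFun_swapFun] using congrArg swapFun h

/-- The swap of a right step is the right step by the flipped letter: `swap (h s, j′) = ((σ h)(σ s), 1 − j′)`. [this work] -/
theorem swapFun_mul_letter (a p : Heis3 × Fin 2) : swapFun (a.1 * p.1, p.2) = ((swapFun a).1 * flipFun p.1, 1 - p.2) := by
  simp only [swapFun, flipFun_mul]

/-- The swap sends the bond of a pattern letter to the bond of the flipped letter. [this work] -/
theorem adj_swapFun_of_mem (a : Heis3 × Fin 2) {p : Heis3 × Fin 2} (hp : p ∈ P a.2) (hne : a ≠ (a.1 * p.1, p.2)) :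
    (PatternGraph.graph P).Adj (swapFun a) (swapFun (a.1 * p.1, p.2)) := by
  rw [swapFun_mul_letter]
  exact PatternGraph.adj_of_mem P (swapFun a) (mem_P_swap a.2 p hp) fun e => hne (swapFun_injective (e.trans (swapFun_mul_letter a p).symm))

/-- **The swap preserves adjacency.** [this work] -/
theorem adj_swapFun {a b : Heis3 × Fin 2} (h : (PatternGraph.graph P).Adj a b) : (PatternGraph.graph P).Adj (swapFun a) (swapFun b) := by
  obtain ⟨hne, h | h⟩ := (PatternGraph.adj_iff P _ _).1 h
  · obtain ⟨p, hp, rfl⟩ := h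
    exact adj_swapFun_of_mem a hp hne
  · obtain ⟨p, hp, rfl⟩ := h
    exact (adj_swapFun_of_mem b hp (Ne.symm hne)).symm

/-- **The sheet swap is an automorphism of the Heisenberg skew bilayer.** [this work] -/
def swapIso : PatternGraph.graph P ≃g PatternGraph.graph P where
  toEquiv := ⟨swapFun, swapFun, swapFun_swapFun, swapFun_swapFun⟩
  map_rel_iff' := by
    intro a b
    refine ⟨fun h => ?_, adj_swapFun⟩
    have h2 := adj_swapFun h
    change (PatternGraph.graph P).Adj (swapFun (swapFun a)) (swapFun (swapFun b)) at h2
    rwa [swapFun_swapFun, swapFun_swapFun] at h2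

/-- `swapIso a = swap a`. [this work] -/
@[simp] theorem swapIso_apply (a : Heis3 × Fin 2) : swapIso a = swapFun a := rfl

/-- **`swap ∘ L_g = L_{σ g} ∘ swap`**: the swap normalises the left translations, so `⟨L_{H₃(ℤ)}, swap⟩ = L_{H₃(ℤ)} ⋊ ⟨swap⟩`. [this work] -/
theorem swapFun_leftIso (g : Heis3) (a : Heis3 × Fin 2) : swapIso (PatternGraph.leftIso P g a) = PatternGraph.leftIso P (flipFun g) (swapIso a) := by
  simp only [swapIso_apply, PatternGraph.leftIso_apply, swapFun, flipFun_mul]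

/-- The swap exchanges the sheets. [this work] -/
theorem swapFun_snd_ne (a : Heis3 × Fin 2) : (swapFun a).2 ≠ a.2 := by
  rw [swapFun_snd]
  rcases fin_two_eq_zero_or_one a.2 with h | h <;> rw [h] <;> decide

/-- **THE HEISENBERG SKEW BILAYER IS VERTEX-TRANSITIVE**: a left translation inside a sheet, the swap followed by a left translation across. [this work] -/
theorem vertexTransitive (a b : Heis3 × Fin 2) : ∃ γ : PatternGraph.graph P ≃g PatternGraph.graph P, γ a = b := by
  by_cases h : a.2 = b.2
  · refine ⟨PatternGraph.leftIso P (b.1 * a.1⁻¹), Prod.ext ?_ ?_⟩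
    · rw [PatternGraph.leftIso_apply, inv_mul_cancel_right]
    · rw [PatternGraph.leftIso_apply]; exact h
  · refine ⟨swapIso.trans (PatternGraph.leftIso P (b.1 * (flipFun a.1)⁻¹)), ?_⟩
    show PatternGraph.leftIso P (b.1 * (flipFun a.1)⁻¹) (swapIso a) = b
    rw [swapIso_apply, PatternGraph.leftIso_apply]
    refine Prod.ext ?_ ?_
    · rw [swapFun_fst, inv_mul_cancel_right]
    · rw [swapFun_snd]
      obtain ⟨v, j⟩ := a
      obtain ⟨w, j'⟩ := b
      dsimp only at h ⊢
      rcases fin_two_eq_zero_or_one j with rfl | rfl <;> rcases fin_two_eq_zero_or_one j' with rfl | rfl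
      · exact absurd rfl h
      · decide
      · decide
      · exact absurd rfl h

/-! ## §3 The swap negates the abelianisation chart: the `chart_transl` clause of the orbit theorem fails for the swap -/

/-- **`φ (swap w) = −φ w`.** [this work] -/
theorem chart_swap (w : Heis3 × Fin 2) : φ (swapIso w).1 = -φ w.1 := by
  rw [swapIso_apply, swapFun_fst, φ_flipFun]

/-- **The abelianisation chart is NOT translated by the swap**: the clause `φ (α w) = φ w + (φ (α t) − φ t)` of
`AutChart.criticalContinuity_of_autSubgroup_finite_orbits` (with `t = (1, 0)`) fails for `α = swap` at `w = (a, 0)` (`−e₀ ≠ e₀`).  So the simply transitive group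
`⟨L_{H₃(ℤ)}, swap⟩` exhibited here is NOT a one-type frame for this chart; other automorphisms / charts are not excluded (the one-type-ability of `X` is OPEN). [this work] -/
theorem not_chart_transl_swap : ¬ ∀ w : Heis3 × Fin 2,
    φ (swapIso w).1 = φ w.1 + (φ (swapIso (((1 : Heis3), (0 : Fin 2)) : Heis3 × Fin 2)).1 - φ (((1 : Heis3), (0 : Fin 2)) : Heis3 × Fin 2).1) := by
  intro h
  have h1 := congrFun (h (gA, 0)) 0
  simp [φ, gA, Heis3.flipFun] at h1

end Heis3Skew

end Summit.CriticalPhenomena.PercolationContinuityZ3.Theorems.Transplant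

end
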